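import Literature.Algebra.Lie.OrthogonalSemisimpleTypeDTwo
import HarnessLib

/-!
# `𝔰𝔬(U, B)` as a Mathlib `LieAlgebra.IsSimple` / `IsSemisimple`: simple for `dim U ≥ 3`, `≠ 4`, semisimple for all `dim U ≥ 3` (Looijenga–Lunts (7.5): `𝔤_-(U) = 𝔞𝔲𝔱(U)` irreducible; Humphreys §19.2)

Topic `Literature/Algebra/Lie` (namespace `Literature.Algebra.Lie.OrthogonalAlgebraSimpleClass`).  Lane `lit-hodgefound`
(Track 2 foundations library), Layer A1, skeleton seat `lit-hodgefound-skel-1` (generation 50), row **A1-187** of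
`run/shared/lean/pub/lit-hodgefound/SKELETON.md`.  Rows A1-171/172 (`OrthogonalAlgebraSimple.lean`) prove that every
`ad(𝔰𝔬(U, B))`-stable subspace of `𝔰𝔬(U, B) ⊆ End(U)` is `⊥` or everything (hyperbolic bases of type `D_ℓ`, `ℓ ≥ 3`,
and `B_ℓ`, `ℓ ≥ 1`; all `dim U ≥ 3`, `≠ 4` over an algebraically closed field) but, as recorded in that file's Scope (a),
do NOT derive Mathlib's class `LieAlgebra.IsSimple K (skewAdjointLieSubalgebra B)`.  This file does (§1 converts
"⊥ or everything" for stable subspaces into "every Lie ideal is `⊥` or `⊤`" and transports non-commutativity from two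
matrices), and adds the SEMISIMPLICITY of `𝔰𝔬(U, B)` for ALL `dim U ≥ 3` in characteristic `0` (`dim U = 4` being
row A1-180's `D_2`).  THEOREMS ONLY; no definition, no named fact, no `sorry` (net debt `0`); no instance, no notation.

## Sources

* [LooijengaLunts1997] Appendix Lemma (7.5), p. 28 L86–L90 (held TeX `paper:arxiv-alg-geom_9604014`): "`𝔤𝔩_-(U) = 𝔞𝔲𝔱(U)`
  … The summands are irreducible, except when `U` is an inner product space of dimension `4`."
* [Humphreys1972] §19.2 p. 102 (the classical algebras `B_ℓ`, `D_ℓ` are simple), §6 Exercise 5(b) p. 30 ("a classical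
  linear Lie algebra is semisimple"), §1.2 pp. 3–4 (the bases), §2.1 p. 6 (ideals).
* [Hall2015] Corollary 8.47 (`𝔰𝔬(n; ℂ)` is simple for `n ≥ 3`, `n ≠ 4`).

## Contents (all proved)

* §1 `lieIdeal_eq_bot_or_eq_top_of_core`, `isSimple_of_core`, `not_isLieAbelian_of_matrices`;
* §2 `not_isLieAbelian_of_toMatrix_eq_JD` (`[p_{uv}, n_{uv}] = h_u + h_v ≠ 0`), `not_isLieAbelian_of_toMatrix_eq_JB`
  (`[h_a, u_a] = u_a ≠ 0`), **`isSimple_of_toMatrix_eq_JD`** (`|m| ≥ 3`), **`isSimple_of_toMatrix_eq_JB`** (`m ≠ ∅`);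
* §3 **`isSimple_of_finrank`** (`K` algebraically closed, `2 ≠ 0`, `B` non-degenerate symmetric, `3 ≤ dim U ≠ 4`),
  **`isSemisimple_of_finrank`** (characteristic `0`, all `dim U ≥ 3`), `hasTrivialRadical_of_finrank`,
  `isSimple_of_finrank_of_flip_eq`.

## Scope

`dim U ≤ 2`: `𝔰𝔬(U)` is `0` or abelian (rows A1-167, A1-173) — not restated.  Real non-split signatures are not treated.
Nothing here is a case of the Hodge conjecture.
-/

namespace Literature.Algebra.Lie.OrthogonalAlgebraSimpleClass

open Module Sum Matrix LieAlgebra LieAlgebra.Orthogonal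

variable {K : Type*} [Field K] {V : Type*} [AddCommGroup V] [Module K V] {B : LinearMap.BilinForm K V}

/-! ### §1 From "⊥ or everything" for `ad`-stable subspaces to the Lie ideals of `skewAdjointLieSubalgebra B` -/

/-- If every `ad(𝔰𝔬(U, B))`-stable `K`-subspace of `𝔰𝔬(U, B) ⊆ End(U)` is `⊥` or `𝔰𝔬(U, B)`, then every Lie ideal of
the Lie subalgebra `skewAdjointLieSubalgebra B` is `⊥` or `⊤`. [folklore] [cite: Humphreys1972, §2.1 p. 6 (ideals), §19.2] -/
theorem lieIdeal_eq_bot_or_eq_top_of_core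
    (core : ∀ P : Submodule K (Module.End K V), P ≤ B.skewAdjointSubmodule →
      (∀ a ∈ B.skewAdjointSubmodule, ∀ x ∈ P, ⁅a, x⁆ ∈ P) → P = ⊥ ∨ P = B.skewAdjointSubmodule)
    (I : LieIdeal K (skewAdjointLieSubalgebra B)) : I = ⊥ ∨ I = ⊤ := by
  classical
  letI : LieRing (Module.End K V) := LieRing.ofAssociativeRing
  letI : LieAlgebra K (Module.End K V) := LieAlgebra.ofAssociativeAlgebra
  set P : Submodule K (Module.End K V) :=
    (I : Submodule K (skewAdjointLieSubalgebra B)).map (skewAdjointLieSubalgebra B).toSubmodule.subtype with hPdef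
  have hPmem : ∀ {x : Module.End K V}, x ∈ P ↔
      ∃ hx : x ∈ skewAdjointLieSubalgebra B, (⟨x, hx⟩ : skewAdjointLieSubalgebra B) ∈ I := by
    intro x
    rw [hPdef, Submodule.mem_map]
    constructor
    · rintro ⟨y, hy, rfl⟩
      exact ⟨y.2, hy⟩
    · rintro ⟨hx, hxI⟩
      exact ⟨⟨x, hx⟩, hxI, rfl⟩
  have hP : P ≤ B.skewAdjointSubmodule := fun x hx ↦ (hPmem.1 hx).1
  have hstab : ∀ a ∈ B.skewAdjointSubmodule, ∀ x ∈ P, ⁅a, x⁆ ∈ P := by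
    intro a ha x hx
    obtain ⟨hx, hxI⟩ := hPmem.1 hx
    exact hPmem.2 ⟨_, I.lie_mem (x := (⟨a, ha⟩ : skewAdjointLieSubalgebra B)) hxI⟩
  rcases core P hP hstab with hbot | hall
  · left
    rw [eq_bot_iff]
    intro x hx
    rw [LieSubmodule.mem_bot]
    have hxP : (x : Module.End K V) ∈ P := hPmem.2 ⟨x.2, hx⟩
    rw [hbot, Submodule.mem_bot] at hxP
    exact Subtype.ext hxP
  · right
    rw [eq_top_iff]
    rintro y -
    have hy : (y : Module.End K V) ∈ P := by rw [hall]; exact y.2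
    obtain ⟨_, hyI⟩ := hPmem.1 hy
    exact hyI

/-- … hence `skewAdjointLieSubalgebra B` is a SIMPLE Lie algebra as soon as it is not abelian. [folklore] [cite: Humphreys1972, §2.1 p. 6, §19.2] -/
theorem isSimple_of_core
    (core : ∀ P : Submodule K (Module.End K V), P ≤ B.skewAdjointSubmodule →
      (∀ a ∈ B.skewAdjointSubmodule, ∀ x ∈ P, ⁅a, x⁆ ∈ P) → P = ⊥ ∨ P = B.skewAdjointSubmodule)
    (hna : ¬IsLieAbelian (skewAdjointLieSubalgebra B)) : LieAlgebra.IsSimple K (skewAdjointLieSubalgebra B) :=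
  ⟨lieIdeal_eq_bot_or_eq_top_of_core core, hna⟩

/-- **Non-commutativity transported from matrices**: if, in a basis `b` with Gram matrix `G`, two `G`-skew matrices `X`,
`Y` have `XY - YX ≠ 0`, then `skewAdjointLieSubalgebra B` is not abelian. [folklore] [cite: Humphreys1972, §1.2, §19.2] -/
theorem not_isLieAbelian_of_matrices {n : Type*} [Fintype n] [DecidableEq n] (b : Basis n K V)
    {X Y : Matrix n n K} (hX : (LinearMap.BilinForm.toMatrix b B).IsSkewAdjoint X)
    (hY : (LinearMap.BilinForm.toMatrix b B).IsSkewAdjoint Y) (hne : X * Y - Y * X ≠ 0) :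
    ¬IsLieAbelian (skewAdjointLieSubalgebra B) := by
  classical
  letI : LieRing (Module.End K V) := LieRing.ofAssociativeRing
  letI : LieAlgebra K (Module.End K V) := LieAlgebra.ofAssociativeAlgebra
  let Φ : Module.End K V ≃ₗ[K] Matrix n n K := LinearMap.toMatrix b b
  have hΦmul : ∀ S T : Module.End K V, Φ (S * T) = Φ S * Φ T := fun S T ↦ LinearMap.toMatrix_mul b S T
  have hmem : ∀ Z : Matrix n n K, (LinearMap.BilinForm.toMatrix b B).IsSkewAdjoint Z →
      Φ.symm Z ∈ skewAdjointLieSubalgebra B := by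
    intro Z hZ
    change Φ.symm Z ∈ B.skewAdjointSubmodule
    rw [SymplecticAlgebraSimple.mem_skewAdjointSubmodule_iff_isSkewAdjoint_toMatrix b B, LinearEquiv.apply_symm_apply]
    exact hZ
  intro h
  have hc := h.trivial ⟨_, hmem X hX⟩ ⟨_, hmem Y hY⟩
  have hc' := congrArg (fun z : skewAdjointLieSubalgebra B ↦ Φ (z : Module.End K V)) hc
  simp only [LieSubalgebra.coe_bracket, ZeroMemClass.coe_zero, map_zero, Ring.lie_def, map_sub, hΦmul,
    LinearEquiv.apply_symm_apply] at hc'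
  exact hne hc'

/-! ### §2 The split forms: `𝔰𝔬(U, B)` is simple for a Gram-`JD m K` basis (`|m| ≥ 3`) and a Gram-`JB m K` basis (`|m| ≥ 1`) -/

/-- For a basis with Gram matrix `JD m K` and `|m| ≥ 2`, `𝔰𝔬(U, B)` is not abelian: `[p_{uv}, n_{uv}] = h_u + h_v ≠ 0`
(row A1-168's table). [cite: Humphreys1972, §1.2 p. 4, §19.2] -/
theorem not_isLieAbelian_of_toMatrix_eq_JD {m : Type*} [Fintype m] [DecidableEq m] (b : Basis (m ⊕ m) K V)
    (hb : LinearMap.BilinForm.toMatrix b B = JD m K) {u v : m} (huv : u ≠ v) :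
    ¬IsLieAbelian (skewAdjointLieSubalgebra B) := by
  refine not_isLieAbelian_of_matrices b (X := single (inr u) (inl v) (1 : K) - single (inr v) (inl u) 1)
    (Y := single (inl u) (inr v) (1 : K) - single (inl v) (inr u) 1) ?_ ?_ ?_
  · rw [hb, OrthogonalSimpleTypeD.isSkewAdjoint_JD_iff_mem_typeD]
    exact OrthogonalSimpleTypeD.single_inr_inl_sub_mem_typeD u v
  · rw [hb, OrthogonalSimpleTypeD.isSkewAdjoint_JD_iff_mem_typeD]
    exact OrthogonalSimpleTypeD.single_inl_inr_sub_mem_typeD u v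
  · rw [OrthogonalSimpleTypeD.psub_comm_nsub huv]
    intro h
    have h' := congrArg (fun M : Matrix (m ⊕ m) (m ⊕ m) K ↦ M (inl u) (inl u)) h
    have hvu : v ≠ u := huv.symm
    simp [Matrix.add_apply, Matrix.sub_apply, hvu] at h'

/-- For a basis with Gram matrix `JB m K` and `m` non-empty, `𝔰𝔬(U, B)` is not abelian: `[h_a, u_a] = u_a ≠ 0`
(row A1-170's table). [cite: Humphreys1972, §1.2 p. 3, §19.2] -/
theorem not_isLieAbelian_of_toMatrix_eq_JB {m : Type*} [Fintype m] [DecidableEq m] (b : Basis (Unit ⊕ (m ⊕ m)) K V)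
    (hb : LinearMap.BilinForm.toMatrix b B = JB m K) (a : m) : ¬IsLieAbelian (skewAdjointLieSubalgebra B) := by
  refine not_isLieAbelian_of_matrices b
    (X := single (inr (inl a)) (inr (inl a)) (1 : K) - single (inr (inr a)) (inr (inr a)) 1)
    (Y := single (inl ()) (inr (inr a)) (1 : K) - (2 : K) • single (inr (inl a)) (inl ()) 1) ?_ ?_ ?_
  · rw [hb, OrthogonalAlgebraSimple.isSkewAdjoint_JB_iff_mem_typeB]
    exact OrthogonalSimpleTypeB.msub_mem_typeB a a
  · rw [hb, OrthogonalAlgebraSimple.isSkewAdjoint_JB_iff_mem_typeB]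
    exact OrthogonalSimpleTypeB.usub_mem_typeB a
  · rw [OrthogonalSimpleTypeB.msub_comm_usub]
    intro h
    have h' := congrArg (fun M : Matrix (Unit ⊕ (m ⊕ m)) (Unit ⊕ (m ⊕ m)) K ↦ M (inl ()) (inr (inr a))) h
    simp [Matrix.sub_apply] at h'

/-- **`𝔰𝔬(U, B)` is a SIMPLE Lie algebra for a basis with Gram matrix `JD m K`, `|m| ≥ 3`, `2 ≠ 0`** (type `D_ℓ`, `ℓ ≥ 3`):
Mathlib's `LieAlgebra.IsSimple K (skewAdjointLieSubalgebra B)` — row A1-172's "⊥ or everything" plus non-commutativity.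
[cite: Humphreys1972, §19.2, p. 102 (type D_ℓ); Hall2015, Cor. 8.47] -/
theorem isSimple_of_toMatrix_eq_JD [NeZero (2 : K)] {m : Type*} [Fintype m] [DecidableEq m] (b : Basis (m ⊕ m) K V)
    (hb : LinearMap.BilinForm.toMatrix b B = JD m K) (h3 : 3 ≤ Fintype.card m) :
    LieAlgebra.IsSimple K (skewAdjointLieSubalgebra B) := by
  obtain ⟨u, v, huv⟩ := Fintype.exists_pair_of_one_lt_card (α := m) (by omega)
  exact isSimple_of_core (fun P hP hstab ↦ OrthogonalAlgebraSimple.eq_bot_or_eq_of_forall_lie_mem_of_toMatrix_eq_JD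
    b hb h3 hP hstab) (not_isLieAbelian_of_toMatrix_eq_JD b hb huv)

/-- **`𝔰𝔬(U, B)` is a SIMPLE Lie algebra for a basis with Gram matrix `JB m K`, `m` non-empty, `2 ≠ 0`** (type `B_ℓ`,
`ℓ ≥ 1`). [cite: Humphreys1972, §19.2, p. 102 (type B_ℓ); Hall2015, Cor. 8.47] -/
theorem isSimple_of_toMatrix_eq_JB [NeZero (2 : K)] {m : Type*} [Fintype m] [DecidableEq m] [Nonempty m]
    (b : Basis (Unit ⊕ (m ⊕ m)) K V) (hb : LinearMap.BilinForm.toMatrix b B = JB m K) :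
    LieAlgebra.IsSimple K (skewAdjointLieSubalgebra B) := by
  obtain ⟨a⟩ := ‹Nonempty m›
  exact isSimple_of_core (fun P hP hstab ↦ OrthogonalAlgebraSimple.eq_bot_or_eq_of_forall_lie_mem_of_toMatrix_eq_JB
    b hb hP hstab) (not_isLieAbelian_of_toMatrix_eq_JB b hb a)

/-! ### §3 Over an algebraically closed field: `𝔰𝔬(U, B)` is simple for `dim U ≥ 3`, `≠ 4`, and semisimple for all `dim U ≥ 3` -/

/-- **`𝔰𝔬(U, B)` IS A SIMPLE LIE ALGEBRA for every non-degenerate symmetric `B` on `U` of dimension `≥ 3`, `≠ 4`, over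
an algebraically closed field with `2 ≠ 0`** (e.g. `ℂ`; Looijenga–Lunts' `𝔞𝔲𝔱(U) = 𝔤_-(U)`, "the summands are
irreducible, except when `U` is an inner product space of dimension `4`") — the Mathlib-class form of row A1-171's
ideal-freeness, closing item (a) of that file's Scope. [cite: LooijengaLunts1997, Appendix Lemma (7.5), p. 28 L86–L90; Humphreys1972, §19.2, p. 102; Hall2015, Cor. 8.47] -/
theorem isSimple_of_finrank [IsAlgClosed K] [NeZero (2 : K)] [FiniteDimensional K V] (hB : B.Nondegenerate)
    (hs : ∀ u v : V, B u v = B v u) (h3 : 3 ≤ finrank K V) (h4 : finrank K V ≠ 4) :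
    LieAlgebra.IsSimple K (skewAdjointLieSubalgebra B) := by
  obtain ⟨m, hm | hm⟩ := Nat.even_or_odd' (finrank K V)
  · obtain ⟨b, hb⟩ := OrthogonalAlgebraSimple.exists_basis_toMatrix_eq_JD hB hs (m := m) (by omega)
    exact isSimple_of_toMatrix_eq_JD b hb (by rw [Fintype.card_fin]; omega)
  · obtain ⟨b, hb⟩ := OrthogonalAlgebraSimple.exists_basis_toMatrix_eq_JB hB hs (m := m) (by omega)
    haveI : Nonempty (Fin m) := ⟨⟨0, by omega⟩⟩
    exact isSimple_of_toMatrix_eq_JB b hb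

/-- **`𝔰𝔬(U, B)` is SEMISIMPLE for every non-degenerate symmetric `B` on `U` of dimension `≥ 3` over an algebraically
closed field of characteristic `0`** — simple for `dim U ≠ 4`, and `D_2 = A_1 × A_1` (row A1-180) for `dim U = 4`.
[cite: Humphreys1972, §6 Exercise 5(b) p. 30 ("a classical linear Lie algebra is semisimple"), §19.2; LooijengaLunts1997, Appendix Lemma (7.5), p. 28] -/
theorem isSemisimple_of_finrank [IsAlgClosed K] [CharZero K] [FiniteDimensional K V] (hB : B.Nondegenerate)
    (hs : ∀ u v : V, B u v = B v u) (h3 : 3 ≤ finrank K V) :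
    LieAlgebra.IsSemisimple K (skewAdjointLieSubalgebra B) := by
  by_cases h4 : finrank K V = 4
  · exact OrthogonalSemisimpleTypeDTwo.isSemisimple_skewAdjoint_of_finrank_eq_four hB hs h4
  · haveI := isSimple_of_finrank hB hs h3 h4
    infer_instance

/-- `𝔰𝔬(U, B)` has trivial radical for `dim U ≥ 3` (algebraically closed field of characteristic `0`).
[cite: Humphreys1972, §6 Exercise 5(b) p. 30, §19.2] -/
theorem hasTrivialRadical_of_finrank [IsAlgClosed K] [CharZero K] [FiniteDimensional K V] (hB : B.Nondegenerate)
    (hs : ∀ u v : V, B u v = B v u) (h3 : 3 ≤ finrank K V) :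
    LieAlgebra.HasTrivialRadical K (skewAdjointLieSubalgebra B) := by
  haveI := isSemisimple_of_finrank hB hs h3
  infer_instance

/-- The `B.flip = B` form of simplicity. [cite: LooijengaLunts1997, Appendix Lemma (7.5), p. 28 L86–L90; Humphreys1972, §19.2] -/
theorem isSimple_of_finrank_of_flip_eq [IsAlgClosed K] [NeZero (2 : K)] [FiniteDimensional K V] (hB : B.Nondegenerate)
    (hflip : B.flip = B) (h3 : 3 ≤ finrank K V) (h4 : finrank K V ≠ 4) :
    LieAlgebra.IsSimple K (skewAdjointLieSubalgebra B) :=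
  isSimple_of_finrank hB (fun u v ↦ by
    have h := LinearMap.congr_fun₂ hflip v u
    rw [LinearMap.BilinForm.flip_apply] at h
    exact h) h3 h4

end Literature.Algebra.Lie.OrthogonalAlgebraSimpleClass
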